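import Mathlib
import Summits.Ventures.HodgeRepro.Tier3PadicComplexInt
import Summits.Ventures.HodgeRepro.Tier3RootsOfUnityEval
import Summits.Ventures.HodgeRepro.Tier4.Line2.BranchCoefficients

/-!
# Tier 4, LINE L2 — L2.3 «torsion points are evaluation points» (seat t4-L2-p3, gen 0)

Blind re-derivation cell `pub-hodge-repro`, Tier-4 prover seat `t4-L2-p3`, LINE L2 (t4-plan-2,
`proofs/t4-plan-2/Tier4/Line2/Skeleton.lean` v0.8 fdd5978f7fcdac64 · 633 l., L238 `hasEval_torsionPt`;
lead S12052 / plan-2 S12073).  `BranchCoefficients` and `BranchCoefficients.IsTorsionPt` are the landed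
byte-verbatim copies of the skeleton's (`Tier4/Line2/BranchCoefficients.lean`).

STATEMENT (byte-verbatim the skeleton's L238–L239):

  `theorem hasEval_torsionPt (O : BranchCoefficients) {d : ℕ} (η : Fin d → 𝓞_ℂ_[O.p]) (hη : O.IsTorsionPt η) :
      MvPowerSeries.HasEval (fun i => η i - 1)`

with `O.IsTorsionPt η := ∀ i, ∃ n : ℕ, η i ^ O.p ^ n = 1`.  Only the prime `O.p` enters, so the content is the
GENERIC statement over `𝓞_ℂ_[p]` for any prime `p` (`hasEval_sub_one_of_forall_pow_prime_pow_eq_one`), of which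
`hasEval_torsionPt` is the instance at `p := O.p`.

PROOF.  `MvPowerSeries.HasEval a` (Mathlib, `RingTheory/MvPowerSeries/Evaluation.lean`) is the conjunction of
(i) `∀ i, IsTopologicallyNilpotent (a i)` and (ii) `Tendsto a cofinite (𝓝 0)`.
(i) is the landed one-variable statement `T3.R2Pinning.hasEval_sub_one_of_pow_prime_pow_eq_one`
(`Tier3RootsOfUnityEval`): in a linearly topologised commutative ring `B` in which `p` is topologically nilpotent,
`ζ − 1` is topologically nilpotent for every `ζ` with `ζ^{p^n} = 1`; for `B = 𝓞_ℂ_[p]` the instance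
`IsLinearTopology 𝓞_ℂ_[p] 𝓞_ℂ_[p]` and the fact `isTopologicallyNilpotent_natCast_prime p` are the landed
`Tier3PadicComplexInt`.  (ii) is trivial: `Fin d` is finite, so `Filter.cofinite = ⊥` (`Filter.cofinite_eq_bot`).

HONESTY.  Mathlib-level glue (R1 (ii)): nothing here is about Hecke characters, `L`-values or the Katz measures.
Nothing here says anything about the status of the Hodge conjecture for CM abelian varieties, which is NOT
proved by anyone in this repository.
-/

set_option autoImplicit false

namespace Summit.Ventures.HodgeRepro.Tier4.Line2

open Summit.Ventures.HodgeRepro.T3.R2Pinning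

/-- **L2.3 (generic form) — torsion points are evaluation points.** For a family `η : Fin d → 𝓞_ℂ_[p]` of
`p`-power roots of unity, `(η_i − 1)_i` is a family at which `d`-variable power series over `𝓞_ℂ_[p]` can be
evaluated (`MvPowerSeries.HasEval`): every `η_i − 1` is topologically nilpotent (coordinatewise the landed
`hasEval_sub_one_of_pow_prime_pow_eq_one`), and the cofinite condition is empty on the finite index set `Fin d`. -/
theorem hasEval_sub_one_of_forall_pow_prime_pow_eq_one {p : ℕ} [Fact p.Prime] {d : ℕ}
    (η : Fin d → 𝓞_ℂ_[p]) (hη : ∀ i, ∃ n : ℕ, η i ^ p ^ n = 1) :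
    MvPowerSeries.HasEval (fun i => η i - 1) where
  hpow i := by
    obtain ⟨n, hn⟩ := hη i
    exact hasEval_sub_one_of_pow_prime_pow_eq_one Fact.out (isTopologicallyNilpotent_natCast_prime p) hn
  tendsto_zero := by
    rw [Filter.cofinite_eq_bot]
    exact Filter.tendsto_bot

/-- **L2.3 (routine) — torsion points are evaluation points**: for a torsion point `η`, `(η_i − 1)_i` is a family
of topologically nilpotent elements of `𝓞_{ℂ_p}` (coordinatewise the landed Tier3RootsOfUnityEval
`hasEval_sub_one_of_pow_prime_pow_eq_one`; the index set is finite). -/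
theorem hasEval_torsionPt (O : BranchCoefficients) {d : ℕ} (η : Fin d → 𝓞_ℂ_[O.p]) (hη : O.IsTorsionPt η) :
    MvPowerSeries.HasEval (fun i => η i - 1) :=
  hasEval_sub_one_of_forall_pow_prime_pow_eq_one η hη

end Summit.Ventures.HodgeRepro.Tier4.Line2
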